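import Literature.Computability.QuantumComplexity.BosonSamplingMainTheorem
import Literature.Computability.QuantumComplexity.BosonSamplingMainTheoremProofs

/-!
# Discharge of named literature fact(s) by composition

This file only composes reductions and discharges that are already in the tree
(no new definitions, no new named facts): each `theorem X_holds : X` below feeds the
proved hypotheses into an existing reduction theorem.  Net effect: the listed facts
stop being literature debt.
-/

namespace Literature.Computability.QuantumComplexity

/-- Discharge of `PSharpP_subset_BPPRelClass_NP_of_uniformApproxBosonSampling` from the proved
main theorem `gpeSolvableInFBPPRel_NPRel_of_approxBosonSamplingOracle_holds` via
`PSharpP_subset_BPPRelClass_NP_of_uniformApproxBosonSampling_of_mainTheorem`.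
[cite: AaronsonArkhipovToC2013, Thm. 1.3 (p. 152) with Cor. 5.9 (p. 195), Conj. 1.5 (p. 153) and Fig. 2 (p. 154)] -/
theorem PSharpP_subset_BPPRelClass_NP_of_uniformApproxBosonSampling_holds :
    PSharpP_subset_BPPRelClass_NP_of_uniformApproxBosonSampling :=
  PSharpP_subset_BPPRelClass_NP_of_uniformApproxBosonSampling_of_mainTheorem
    gpeSolvableInFBPPRel_NPRel_of_approxBosonSamplingOracle_holds

/-- Discharge of `gpeSolvableInFBPPRel_NP_of_uniformApproxBosonSampling` from the proved main
theorem `gpeSolvableInFBPPRel_NPRel_of_approxBosonSamplingOracle_holds` via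
`gpeSolvableInFBPPRel_NP_of_uniformApproxBosonSampling_of_mainTheorem`.
[cite: AaronsonArkhipovToC2013, Thm. 1.3 (p. 152; proof §5.2 pp. 192–195) and Cor. 5.9 (p. 195)] -/
theorem gpeSolvableInFBPPRel_NP_of_uniformApproxBosonSampling_holds :
    gpeSolvableInFBPPRel_NP_of_uniformApproxBosonSampling :=
  gpeSolvableInFBPPRel_NP_of_uniformApproxBosonSampling_of_mainTheorem
    gpeSolvableInFBPPRel_NPRel_of_approxBosonSamplingOracle_holds

end Literature.Computability.QuantumComplexity
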